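import Summits.BirchSwinnertonDyer.BirchSwinnertonDyer.Theorems.ErratumRoadFiveTateTorsionRigidityPadic
import Literature.NumberTheory.EllipticCurves.TateCurve.UniformizationProofs
import Literature.NumberTheory.EllipticCurves.VariableChangePointsMap
import Summits.BirchSwinnertonDyer.Rank1Residual.X11b.LocalTorsionTamagawa
import HarnessLib

/-!
# Route `ErratumRoadFive` (K2, `p ≥ 5`), crux (T) `Rest3TorsionBranchAtFive` (item
# stmt-BirchSwinnertonDyer-19702): Lemma (L1) of THEOREM T♭ FOR THE CURVE ITSELF — an elliptic curve
# `E/ℚ` with split multiplicative reduction at an odd prime `p` acquires no new `p`-power torsion over any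
# normal pro-`p` extension of `ℚ_p` (`E(K_{∞,w})[p^∞] = E(ℚ_p)[p^∞] ≅ ℤ/p^k` on the anticyclotomic local tower)

Cell `bsd-stepL` (run/shared/lean/pub/bsd-stepL/), seat `bsd-stepL-bdp` (prover g14, 2026-08-26), memo
`HOME/proof/PROOF-BDP.md` §31.2 / §32; `--supports stmt-BirchSwinnertonDyer-19702 --as helper`. Third
file of the (L1) chain: `ErratumRoadFiveTateTorsionRigidity.lean` (abstract Tate curve over a complete
ultrametric `K`) → `…Padic.lean` (`tateCurve q` over `ℚ_p`, `p` odd) → THIS FILE (the curve `W/ℚ` of the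
route, in the cell's currency `geomPoints (W.baseChange ℚ_[p])` = `E(ℚ̄_p)` with its
`Gal(ℚ̄_p/ℚ_p)`-action, under `W.HasSplitMultiplicativeReductionAtPrime p` — which on branch (T) follows
from the non-zero `p`-torsion point, `X11b/LocalTorsionTamagawa.split_and_dvd_of_localTorsion_ne_zero`).

The bridge is Silverman ATAEC V.5.3: `W ×_ℚ ℚ_p ≅_{ℚ_p} E_q` for the Tate parameter `q` — the tree's
THEOREM `exists_tateParameter_of_hasSplitMultiplicativeReduction'` (abc-iut cell, V.5.3 (a)(b) + AEC
VII.5.1 (b) discharged in `TateCurve/UniformizationProofs.lean`) — transported to `ℚ̄_p`-points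
`Gal(ℚ̄_p/ℚ_p)`-equivariantly by the tree's `VariableChange.pointEquivBaseChange` ∕
`pointEquivBaseChange_map_algEquiv` (`VariableChangePointsMap.lean`).

* `curve_smul_eq_self_of_fixed_of_torsion` — **(L1) for `W`**: `p` odd, `W/ℚ` elliptic with split
  multiplicative reduction at `p`, `H ⊴ G_{ℚ_p}` normal with `p`-power degrees of fixed elements
  (e.g. `ℚ̄_p^H = K_{∞,w}`): every `H`-fixed `p`-power-torsion point of `W(ℚ̄_p)` is `G_{ℚ_p}`-fixed.
* `curve_exists_generator_fixed_torsion` — the structure form: `∃ k` and ONE `G_{ℚ_p}`-fixed `P₀` of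
  exact order `p^k` generating all of them: `#W(ℚ̄_p^H)[p^∞] = p^k` uniformly in `H` — the constant of
  memo §31.2 (E) at the pair `(W, p)`.
* `branchT_smul_eq_self_of_fixed_of_torsion` ∕ `branchT_exists_generator_fixed_torsion` — the same in the
  crux's binders (`Mult W p`, `3 ≤ p`, a non-zero `p`-torsion point of `E(ℚ_p)`): split reduction is then
  forced (`LocalTorsion.split_and_dvd_of_localTorsion_ne_zero`).

HONEST FRAMING: theorems only (no definition, no named fact, no `sorry`), fact-free; nothing about
Selmer groups or preprints is asserted; nothing is booked; no census word, tier or label moves (T7).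
NOT here (paper, memo §31.2): Shapiro / the identification of `H⁰(K_𝔭, M_E)` with
`⊕_{w ∣ 𝔭} E(K_{∞,w})[p^∞]`, the `g_m`-side bound and the Selmer bookkeeping (objects absent in the tree).

References: [SilvermanATAEC1994] Thm. V.3.1 (c),(d), Thm. V.5.3 (PDF pp. 395–399, 407–409);
[SilvermanAEC2009] III.3.1 (b), VIII.§1; [Castella2018Erratum] Lemma 2.1, Remark (2); memo §31.2, §32.
-/

set_option autoImplicit false
-- the Theorems namespace of this sub repeats the summit name by design (D-0017 nested layout)
set_option linter.dupNamespace false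

noncomputable section

open scoped Classical

namespace Summit.BirchSwinnertonDyer.BirchSwinnertonDyer.Theorems.TateTorsionRigidity

open Field WeierstrassCurve Literature.NumberTheory.EllipticCurves
  Literature.NumberTheory.EllipticCurves.TateCurve Literature.NumberTheory.EllipticCurves.SteinWuthrich2013

variable {p : ℕ} [Fact p.Prime]

/-- `‖x‖ ≤ 1 ↔ x ∈ ℤ_p` in `ℚ_p`: the valuation ring of `ℚ_p` is `ℤ_p` (the shape of the `hR` binder of the
tree's V.5.3 theorems). [folklore] -/
theorem padic_norm_le_one_iff_mem_range (x : ℚ_[p]) :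
    ‖x‖ ≤ 1 ↔ x ∈ Set.range (algebraMap ℤ_[p] ℚ_[p]) := by
  constructor
  · intro h
    exact ⟨⟨x, h⟩, rfl⟩
  · rintro ⟨y, rfl⟩
    exact y.2

/-- **Lemma (L1) of THEOREM T♭ for the curve (memo §31.2, PROVED in the kernel).** `p` an odd prime,
`W/ℚ` an elliptic curve with SPLIT multiplicative reduction at `p`
(`W.HasSplitMultiplicativeReductionAtPrime p`; on branch (T) forced by the non-zero `p`-torsion point),
`H ⊴ Gal(ℚ̄_p/ℚ_p)` a normal subgroup all of whose fixed elements have `p`-power degree over `ℚ_p` (e.g.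
`ℚ̄_p^H = K_{∞,w}`, the anticyclotomic local tower, a `ℤ_p`-extension of `K_𝔭 = ℚ_p`). Then every
`H`-fixed `p`-power-torsion point of `W(ℚ̄_p)` is fixed by all of `Gal(ℚ̄_p/ℚ_p)`:
**`W(ℚ̄_p^H)[p^∞] = W(ℚ_p)[p^∞]`** — «a Tate curve acquires no new `p`-power torsion in the
anticyclotomic local tower», the boundedness input of the (iv)-free erratum road. Proof: V.5.3
(`exists_tateParameter_of_hasSplitMultiplicativeReduction'`) gives `C • W_{ℚ_p} = E_q`; transport along
`pointEquivBaseChange` (equivariant, additive, injective) to `padic_smul_eq_self_of_fixed_of_torsion`.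
[cite: SilvermanATAEC1994, Thm. V.5.3 (PDF pp. 407–409)] -/
theorem curve_smul_eq_self_of_fixed_of_torsion (hp2 : p ≠ 2) (W : WeierstrassCurve ℚ) [W.IsElliptic]
    (hsplit : W.HasSplitMultiplicativeReductionAtPrime p)
    (H : Subgroup (absoluteGaloisGroup ℚ_[p])) [H.Normal]
    (hdeg : ∀ x : AlgebraicClosure ℚ_[p], (∀ τ ∈ H, τ • x = x) →
      ∃ j : ℕ, (minpoly ℚ_[p] x).natDegree = p ^ j)
    (P : geomPoints (W.baseChange ℚ_[p])) {n : ℕ} (hP : (p ^ n) • P = 0)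
    (hfix : ∀ τ ∈ H, τ • P = P) (σ : absoluteGaloisGroup ℚ_[p]) : σ • P = P := by
  haveI : (W.baseChange ℚ_[p]).IsElliptic := inferInstanceAs (W.map (algebraMap ℚ ℚ_[p])).IsElliptic
  have hsplit' : ∃ C : VariableChange ℚ_[p],
      (C • W.baseChange ℚ_[p]).HasSplitMultiplicativeReduction ℤ_[p] := ⟨_, hsplit⟩
  obtain ⟨q, hq0, hq1, -, -, C, hC⟩ :=
    exists_tateParameter_of_hasSplitMultiplicativeReduction' ℤ_[p] padic_norm_le_one_iff_mem_range
      (W.baseChange ℚ_[p]) hsplit'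
  -- the statement for the `ℚ_p`-isomorphic curve `C • W_{ℚ_p} = E_q`
  have key : ∀ Q : geomPoints (C • W.baseChange ℚ_[p]), (p ^ n) • Q = 0 → (∀ τ ∈ H, τ • Q = Q) →
      σ • Q = Q := by
    rw [hC]
    intro Q hQ hQfix
    exact padic_smul_eq_self_of_fixed_of_torsion hp2 q hq0 hq1 H hdeg Q hQ hQfix σ
  -- transport along the equivariant isomorphism `ψ : W(ℚ̄_p) ≃+ (C • W_{ℚ_p})(ℚ̄_p)`
  let ψ : geomPoints (W.baseChange ℚ_[p]) ≃+ geomPoints (C • W.baseChange ℚ_[p]) :=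
    VariableChange.pointEquivBaseChange (W.baseChange ℚ_[p]) C (AlgebraicClosure ℚ_[p])
  have hψ : ∀ (τ : absoluteGaloisGroup ℚ_[p]) (Q : geomPoints (W.baseChange ℚ_[p])),
      ψ (τ • Q) = τ • ψ Q :=
    fun τ Q => VariableChange.pointEquivBaseChange_map_algEquiv (W.baseChange ℚ_[p]) C
      (absoluteGaloisGroup.toAlgEquiv ℚ_[p] τ) Q
  have h1 : (p ^ n) • ψ P = 0 := by rw [← map_nsmul, hP, map_zero]
  have h2 : ∀ τ ∈ H, τ • ψ P = ψ P := fun τ hτ => by rw [← hψ, hfix τ hτ]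
  have h3 := key (ψ P) h1 h2
  rw [← hψ] at h3
  exact ψ.injective h3

/-- **(L1) for the curve, structure form: `W(ℚ̄_p^H)[p^∞] = W(ℚ_p)[p^∞] ≅ ℤ/p^k` on ONE `ℚ_p`-rational
generator, `k` depending on `(W, p)` alone** (`k = max{j : q_E ∈ (ℚ_p^×)^{p^j}}`): under the hypotheses of
`curve_smul_eq_self_of_fixed_of_torsion` there are `k : ℕ` and a `Gal(ℚ̄_p/ℚ_p)`-fixed `P₀ ∈ W(ℚ̄_p)` of
exact order `p ^ k` such that every `H`-fixed `p`-power-torsion point is an integer multiple of `P₀` — so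
`#H⁰(K_{∞,w}, E[p^∞]) = p^k` for every layer and every such tower: the constant `c₀` of memo §31.2 (E)
at the pair. Transport of `padic_exists_generator_fixed_torsion` along `pointEquivBaseChange`.
[cite: SilvermanATAEC1994, Thm. V.5.3 (PDF pp. 407–409)] -/
theorem curve_exists_generator_fixed_torsion (hp2 : p ≠ 2) (W : WeierstrassCurve ℚ) [W.IsElliptic]
    (hsplit : W.HasSplitMultiplicativeReductionAtPrime p)
    (H : Subgroup (absoluteGaloisGroup ℚ_[p])) [H.Normal]
    (hdeg : ∀ x : AlgebraicClosure ℚ_[p], (∀ τ ∈ H, τ • x = x) →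
      ∃ j : ℕ, (minpoly ℚ_[p] x).natDegree = p ^ j) :
    ∃ (k : ℕ) (P₀ : geomPoints (W.baseChange ℚ_[p])),
      (∀ σ : absoluteGaloisGroup ℚ_[p], σ • P₀ = P₀) ∧ (p ^ k) • P₀ = 0 ∧
      (∀ j : ℕ, j • P₀ = 0 → p ^ k ∣ j) ∧
      ∀ (P : geomPoints (W.baseChange ℚ_[p])) (n : ℕ), (p ^ n) • P = 0 →
        (∀ τ ∈ H, τ • P = P) → ∃ j : ℤ, P = j • P₀ := by
  haveI : (W.baseChange ℚ_[p]).IsElliptic := inferInstanceAs (W.map (algebraMap ℚ ℚ_[p])).IsElliptic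
  have hsplit' : ∃ C : VariableChange ℚ_[p],
      (C • W.baseChange ℚ_[p]).HasSplitMultiplicativeReduction ℤ_[p] := ⟨_, hsplit⟩
  obtain ⟨q, hq0, hq1, -, -, C, hC⟩ :=
    exists_tateParameter_of_hasSplitMultiplicativeReduction' ℤ_[p] padic_norm_le_one_iff_mem_range
      (W.baseChange ℚ_[p]) hsplit'
  -- the statement for `C • W_{ℚ_p} = E_q`
  have key : ∃ (k : ℕ) (Q₀ : geomPoints (C • W.baseChange ℚ_[p])),
      (∀ σ : absoluteGaloisGroup ℚ_[p], σ • Q₀ = Q₀) ∧ (p ^ k) • Q₀ = 0 ∧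
      (∀ j : ℕ, j • Q₀ = 0 → p ^ k ∣ j) ∧
      ∀ (Q : geomPoints (C • W.baseChange ℚ_[p])) (n : ℕ), (p ^ n) • Q = 0 →
        (∀ τ ∈ H, τ • Q = Q) → ∃ j : ℤ, Q = j • Q₀ := by
    rw [hC]
    exact padic_exists_generator_fixed_torsion hp2 q hq0 hq1 H hdeg
  obtain ⟨k, Q₀, hG, hk, hord, hgen⟩ := key
  let ψ : geomPoints (W.baseChange ℚ_[p]) ≃+ geomPoints (C • W.baseChange ℚ_[p]) :=
    VariableChange.pointEquivBaseChange (W.baseChange ℚ_[p]) C (AlgebraicClosure ℚ_[p])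
  have hψ : ∀ (τ : absoluteGaloisGroup ℚ_[p]) (Q : geomPoints (W.baseChange ℚ_[p])),
      ψ (τ • Q) = τ • ψ Q :=
    fun τ Q => VariableChange.pointEquivBaseChange_map_algEquiv (W.baseChange ℚ_[p]) C
      (absoluteGaloisGroup.toAlgEquiv ℚ_[p] τ) Q
  refine ⟨k, ψ.symm Q₀, ?_, ?_, ?_, ?_⟩
  · intro σ
    apply ψ.injective
    rw [hψ, AddEquiv.apply_symm_apply, hG σ]
  · apply ψ.injective
    rw [map_nsmul, AddEquiv.apply_symm_apply, hk, map_zero]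
  · intro j hj
    refine hord j ?_
    rw [← AddEquiv.apply_symm_apply ψ Q₀, ← map_nsmul, hj, map_zero]
  · intro P n hP hfix
    obtain ⟨j, hj⟩ := hgen (ψ P) n (by rw [← map_nsmul, hP, map_zero])
      (fun τ hτ => by rw [← hψ, hfix τ hτ])
    refine ⟨j, ψ.injective ?_⟩
    rw [hj, map_zsmul, AddEquiv.apply_symm_apply]

/-- **(L1) ON BRANCH (T), in the crux's own binders** (item 19702 `Rest3TorsionBranchAtFive`: a
multiplicative `p ≥ 3` — in the route `p ≥ 5` — with a NON-ZERO `p`-torsion point in `E(ℚ_p)`): the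
torsion point forces SPLIT reduction (the cell's `LocalTorsion.split_and_dvd_of_localTorsion_ne_zero`,
multr1 gen 7), and `curve_smul_eq_self_of_fixed_of_torsion` applies: for every normal `H ≤ Gal(ℚ̄_p/ℚ_p)`
with `p`-power degrees of fixed elements (the anticyclotomic local tower `K_{∞,w}/K_𝔭 = ℚ_p` at the split
erratum prime `𝔭`), **`E(ℚ̄_p^H)[p^∞] = E(ℚ_p)[p^∞]`** — Lemma (L1) of memo §31.2 exactly where THEOREM T♭
uses it (hypothesis (iv) FAILS on these rows, and the control defect it governs is bounded by this
lemma). [cite: Castella2018Erratum, Lemma 2.1 and Remark (2) (p. 2)]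
[cite: SilvermanATAEC1994, Thm. V.5.3 (PDF pp. 407–409)] -/
theorem branchT_smul_eq_self_of_fixed_of_torsion (W : WeierstrassCurve ℚ) [W.IsElliptic]
    [W.IsGloballyMinimal] (hp3 : 3 ≤ p)
    (hmult : Literature.NumberTheory.EllipticCurves.Rank1Residual.Mult W p)
    (hT : ∃ P : (W.baseChange ℚ_[p]).toAffine.Point, p • P = 0 ∧ P ≠ 0)
    (H : Subgroup (absoluteGaloisGroup ℚ_[p])) [H.Normal]
    (hdeg : ∀ x : AlgebraicClosure ℚ_[p], (∀ τ ∈ H, τ • x = x) →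
      ∃ j : ℕ, (minpoly ℚ_[p] x).natDegree = p ^ j)
    (P : geomPoints (W.baseChange ℚ_[p])) {n : ℕ} (hP : (p ^ n) • P = 0)
    (hfix : ∀ τ ∈ H, τ • P = P) (σ : absoluteGaloisGroup ℚ_[p]) : σ • P = P := by
  obtain ⟨P₁, hP₁, hne⟩ := hT
  have hsplit : W.HasSplitMultiplicativeReductionAtPrime p :=
    (Summit.BirchSwinnertonDyer.Rank1Residual.X11b.LocalTorsion.split_and_dvd_of_localTorsion_ne_zero
      W p hp3 hmult P₁ hP₁ hne).1
  have hp2 : p ≠ 2 := by omega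
  exact curve_smul_eq_self_of_fixed_of_torsion hp2 W hsplit H hdeg P hP hfix σ

/-- **Branch (T), structure form**: on a (T) pair the `H`-fixed `p`-power torsion of `E(ℚ̄_p)` is cyclic
of order `p^k` on one `ℚ_p`-rational generator, `k ≥ 1` depending on `(E, p)` only — the bound
`#H⁰(K_{∞,w}, E[p^∞]) = p^k` of memo §31.2 (E), uniform in the layer `m` (the constant that the
defect-tolerant congruence limit `BoundedCongruenceLimit.charIdeal_le_span_of_congruences_boundedKernel`
absorbs). [cite: Castella2018Erratum, Lemma 2.1 and Remark (2) (p. 2)]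
[cite: SilvermanATAEC1994, Thm. V.5.3 (PDF pp. 407–409)] -/
theorem branchT_exists_generator_fixed_torsion (W : WeierstrassCurve ℚ) [W.IsElliptic]
    [W.IsGloballyMinimal] (hp3 : 3 ≤ p)
    (hmult : Literature.NumberTheory.EllipticCurves.Rank1Residual.Mult W p)
    (hT : ∃ P : (W.baseChange ℚ_[p]).toAffine.Point, p • P = 0 ∧ P ≠ 0)
    (H : Subgroup (absoluteGaloisGroup ℚ_[p])) [H.Normal]
    (hdeg : ∀ x : AlgebraicClosure ℚ_[p], (∀ τ ∈ H, τ • x = x) →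
      ∃ j : ℕ, (minpoly ℚ_[p] x).natDegree = p ^ j) :
    ∃ (k : ℕ) (P₀ : geomPoints (W.baseChange ℚ_[p])),
      (∀ σ : absoluteGaloisGroup ℚ_[p], σ • P₀ = P₀) ∧ (p ^ k) • P₀ = 0 ∧
      (∀ j : ℕ, j • P₀ = 0 → p ^ k ∣ j) ∧
      ∀ (P : geomPoints (W.baseChange ℚ_[p])) (n : ℕ), (p ^ n) • P = 0 →
        (∀ τ ∈ H, τ • P = P) → ∃ j : ℤ, P = j • P₀ := by
  obtain ⟨P₁, hP₁, hne⟩ := hT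
  have hsplit : W.HasSplitMultiplicativeReductionAtPrime p :=
    (Summit.BirchSwinnertonDyer.Rank1Residual.X11b.LocalTorsion.split_and_dvd_of_localTorsion_ne_zero
      W p hp3 hmult P₁ hP₁ hne).1
  have hp2 : p ≠ 2 := by omega
  exact curve_exists_generator_fixed_torsion hp2 W hsplit H hdeg

end Summit.BirchSwinnertonDyer.BirchSwinnertonDyer.Theorems.TateTorsionRigidity

end
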